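import Literature.AlgebraicGeometry.Modules.NilThickeningUnipotentRoots
import Mathlib.AlgebraicGeometry.Pullbacks
import HarnessLib

/-!
# Torsion rigidity of `Ȟ¹(𝒪^×)` along a nilpotent thickening: an `n`-torsion class that dies on the closed subscheme is
# trivial (`n` invertible)

Layer `Literature/AlgebraicGeometry/Modules`, namespace `Literature.AlgebraicGeometry.Modules`.  THEOREMS ONLY (no definition,
no named fact, no instance, no notation, no `sorry`).  Cell `hodgecm-mathlib` (D-0151), F-3 sub-line `Cruxes/HDel/Lines/F3DualAbelianScheme`,
stub (K) `stub_F3K`, road T brick (T2) — FILE B of two (A = ★ `Modules/NilThickeningUnipotentRoots`: unipotent `n`-th roots, nil kernel,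
step (a)); census `B-provers/B-p03/g20/F3K/CENSUS-F3K-TorsionRoad.B-p03g20.md` (B-p03 (g20); B-plan1 (g19) words 2026-08-30 19:04:10Z /
19:15:48Z).  HC_CM is proved only modulo the 7 printed citations until rung 0 closes; nothing here is about HC.

SETTING.  `i : X ⟶ X'` a SURJECTIVE CLOSED IMMERSION of schemes such that every unit of `Γ(X, 𝒪_X)` lifts to a unit of `Γ(X', 𝒪_{X'})`
(e.g. `A ×_R Spec κ ↪ A ×_R Spec R'`, `R'` Artin local with residue field `κ`, where both rings of global sections are the base rings — Stein —
and `R' ↠ κ` lifts units), and `n : ℕ` invertible in `Γ(X', 𝒪_{X'})`.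

* **`CechPic.eq_one_of_pow_eq_one_of_pullback_eq_one` — TORSION RIGIDITY**: for `a ∈ Ȟ¹(X', 𝒪^×)` (the tree's `Modules.CechPic`),
  `a ^ n = 1` and `i^* a = 1` imply `a = 1`.  PROOF on point-indexed Čech cocycles: (a) ★ FILE A: represent `a` by `{G_{xy}}` with
  `i♯G_{xy} = 1`; (b) `UnitCocycle.exists_units_app_eq_one`: `[G]^n = 1` reads `G_{xy}^n = λ_x⁻¹ λ_y`; the reductions `i♯λ_x` glue (sheaf
  axiom on `X`, Mathlib `TopCat.Sheaf.existsUnique_gluing'`) to a global unit of `X`, which lifts by hypothesis; untwisting gives units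
  `μ_x` with `i♯μ_x = 1`, i.e. `μ_x ≡ 1` modulo the nil kernel; (c) over affine charts the `μ_x` have unipotent `n`-th roots `ρ_x` (★ FILE A §1)
  and `G_{xy} = ρ_x⁻¹ ρ_y` holds LOCALLY by injectivity of `n`-th powers on unipotent units, hence globally (sheaf axiom on `X'`): `[G] = 1`.
  In `H¹`-language: the kernel of `Pic X' → Pic X` is filtered by the `Γ`-modules `H¹(X, 𝒥^k/𝒥^{k+1})` ([Hartshorne1977] III Ex. 4.6,
  [Hartshorne2010] Thm. 6.4 (b)), on which `n` acts invertibly — so it has NO `n`-TORSION; the cochain proof needs neither `H¹`, nor the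
  filtration, nor a square-zero hypothesis.  Compare ★ `Deformation/CechPicLiftingCharZero.CechPic.pullback_whiskerLeft_surjective` (Mumford's
  lemma: `i^*` is ONTO over `Art_k` in characteristic `0`) — the present statement is about the KERNEL and holds for any invertible `n`.
  [cite: Hartshorne1977, III Ex. 4.6 (`0 → 𝓘 → 𝒪^*_{X'} → 𝒪^*_X → 0` and `Pic X' → Pic X`)]
  [cite: Hartshorne2010, §6 Thm. 6.4 (b) and its proof (pp. 50–51)]

Consumer (census (T6), B-p08 lineage): with `X' = A_T`, `T` an Artin local point of `A[n]` centred on `K(L)`, and `a = (1_A × u)^*[Λ(L)]` —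
`n`-torsion by the theorem of the square (★ `cechPic_pullback_whiskerLeft_mul_mumfordClass_of_isNoetherianRing`) and trivial on the closed
fibre — this gives `u ∈ K(L)(T)`, i.e. `K(L)` is open in the finite étale `A[n]`, hence FLAT over the base: the LACK of `stub_F3K` over a
NON-reduced base ([MumfordAV1970] §13; [MumfordFogartyKirwan1994] Ch. 6 §2 Prop. 6.13 (iii)) without the dual abelian scheme and without `dφ_L`.

## References
* [Hartshorne1977] R. Hartshorne, *Algebraic Geometry*, GTM 52 (1977), III §4, Ex. III.4.4–4.6.
* [Hartshorne2010] R. Hartshorne, *Deformation Theory*, GTM 257 (2010), §6 Thm. 6.4 (pp. 50–51).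
* [AtiyahMacdonald1969] M. F. Atiyah, I. G. Macdonald, *Introduction to Commutative Algebra* (1969), Prop. 1.9, Ch. 10 Ex. 9.
* [MumfordAV1970] D. Mumford, *Abelian Varieties* (1970), §13 (p. 123).
* [MumfordFogartyKirwan1994] D. Mumford, J. Fogarty, F. Kirwan, *Geometric Invariant Theory*, 3rd ed. (1994), Ch. 6 §2 Prop. 6.13 (iii).
-/

noncomputable section

universe u

open CategoryTheory AlgebraicGeometry Opposite TopologicalSpace MonoidalCategory

namespace Literature.AlgebraicGeometry.Modules

section Torsion

variable {X X' : Scheme.{u}} (i : X ⟶ X') [IsClosedImmersion i] [Surjective i]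

/-- An affine open neighbourhood of a point inside a given open (affine opens form a basis). [cite: Hartshorne1977, III §4 Ex. 4.4 (refinements)] -/
private theorem exists_affineOpens_le {x' : X'} {U : X'.Opens} (hx : x' ∈ U) : ∃ A : X'.affineOpens, x' ∈ A.1 ∧ A.1 ≤ U := by
  obtain ⟨A, hA, hxA, hAle⟩ := (Opens.isBasis_iff_nbhd.mp X'.isBasis_affineOpens) hx
  exact ⟨⟨A, hA⟩, hxA, hAle⟩

/-- A natural number `n` that is a unit in `R` is a unit in the target of any ring map out of `R` (bookkeeping for sections over
smaller opens and their reductions). [folklore] -/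
private theorem isUnit_natCast_of_ringHom {R S : Type*} [CommRing R] [CommRing S] {n : ℕ} (f : R →+* S) (hn : IsUnit (n : R)) :
    IsUnit (n : S) := by
  simpa only [map_natCast] using hn.map f

/-- Powers of a class are represented by the powers of the transition functions on the same cover. [cite: Hartshorne1977, III §4 (Čech cocycles)] -/
private theorem CechPic.mk_pow_eq (c : UnitCocycle X') (n : ℕ) :
    CechPic.mk c ^ n =
      CechPic.mk
        { U := c.U
          mem := c.mem
          g := fun x y V hx hy => c.g x y V hx hy ^ n
          map_g := fun x y V V' hx hy j => by rw [map_pow, c.map_g]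
          g_mul := fun x y z V hx hy hz => by rw [← mul_pow, c.g_mul]
          g_self := fun x V hx => by rw [c.g_self, one_pow] } := by
  induction n with
  | zero =>
    rw [pow_zero, ← CechPic.mk_one]
    exact CechPic.sound (UnitCocycle.equiv_of_eq _ _ c.U c.mem (fun _ => le_top) (fun _ => le_rfl)
      fun x y V hx hy => by simp only [pow_zero]; rfl)
  | succ n ih =>
    rw [pow_succ, ih, ← CechPic.mk_mul]
    exact CechPic.sound (UnitCocycle.equiv_of_eq _ _ c.U c.mem (fun _ => le_inf le_rfl le_rfl) (fun _ => le_rfl)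
      fun x y V hx hy => by simp only [pow_succ]; rfl)

/-- A coboundary `λ` between the `n`-th power cocycle `{G_{xy}^n}` (on the cover of `G`) and the trivial cocycle, unpacked: refinement `W_x`,
units `λ_x` with inverses, compatible with restriction, and the relation `λ_y = λ_x G_{xy}^n`. [cite: Hartshorne1977, III §4 (Čech cocycles)] -/
private theorem UnitCocycle.exists_datum_of_mk_pow_eq_one (c : UnitCocycle X') (n : ℕ) (h : CechPic.mk c ^ n = 1) :
    ∃ (W : X' → X'.Opens) (_ : ∀ x, x ∈ W x) (hWU : ∀ x, W x ≤ c.U x)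
      (lam inv : ∀ (x : X') (V : X'.Opens), V ≤ W x → Γ(X', V)),
      (∀ (x : X') (V V' : X'.Opens) (h : V ≤ W x) (j : V' ≤ V), secRes X' j (lam x V h) = lam x V' (j.trans h)) ∧
      (∀ (x : X') (V V' : X'.Opens) (h : V ≤ W x) (j : V' ≤ V), secRes X' j (inv x V h) = inv x V' (j.trans h)) ∧
      (∀ (x : X') (V : X'.Opens) (h : V ≤ W x), lam x V h * inv x V h = 1) ∧
      ∀ (x y : X') (V : X'.Opens) (hx : V ≤ W x) (hy : V ≤ W y),
        lam y V hy = lam x V hx * c.g x y V (hx.trans (hWU x)) (hy.trans (hWU y)) ^ n := by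
  rw [CechPic.mk_pow_eq, ← CechPic.mk_one, CechPic.mk_eq_mk_iff] at h
  obtain ⟨b⟩ := h
  refine ⟨b.W, b.mem, b.le, b.lam, b.inv, fun x V V' h j => b.map_lam x h j, fun x V V' h j => b.map_inv x h j,
    b.lam_mul_inv, fun x y V hx hy => ?_⟩
  have h := b.rel x y V hx hy
  dsimp only [UnitCocycle.one] at h
  rw [one_mul] at h
  exact h

omit [IsClosedImmersion i] [Surjective i] in
/-- **Step (b)**: if `{G_{xy}^n}` is a coboundary `λ_y = λ_x G_{xy}^n` and `i♯G_{xy} = 1`, the units can be RECHOSEN with `i♯μ_x = 1` — the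
reductions `i♯λ_x` glue (sheaf axiom on `X`) to a global unit of `X`, which lifts to a global unit `u` of `X'` by hypothesis; put
`μ_x := λ_x u⁻¹`. [cite: Hartshorne1977, III §4, Ex. 4.4–4.5] [cite: Hartshorne2010, §6 Thm. 6.4 (b) (pp. 50–51)] -/
theorem UnitCocycle.exists_units_app_eq_one
    (hlift : ∀ u : Γ(X, ⊤), IsUnit u → ∃ v : Γ(X', ⊤), IsUnit v ∧ i.appTop v = u)
    (c : UnitCocycle X') (hc : ∀ (x y : X') (V : X'.Opens) (hx : V ≤ c.U x) (hy : V ≤ c.U y), i.app V (c.g x y V hx hy) = 1)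
    (n : ℕ) (W : X' → X'.Opens) (hWmem : ∀ x, x ∈ W x) (hWU : ∀ x, W x ≤ c.U x)
    (lam inv : ∀ (x : X') (V : X'.Opens), V ≤ W x → Γ(X', V))
    (map_lam : ∀ (x : X') (V V' : X'.Opens) (h : V ≤ W x) (j : V' ≤ V), secRes X' j (lam x V h) = lam x V' (j.trans h))
    (map_inv : ∀ (x : X') (V V' : X'.Opens) (h : V ≤ W x) (j : V' ≤ V), secRes X' j (inv x V h) = inv x V' (j.trans h))
    (lam_mul_inv : ∀ (x : X') (V : X'.Opens) (h : V ≤ W x), lam x V h * inv x V h = 1)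
    (rel : ∀ (x y : X') (V : X'.Opens) (hx : V ≤ W x) (hy : V ≤ W y),
      lam y V hy = lam x V hx * c.g x y V (hx.trans (hWU x)) (hy.trans (hWU y)) ^ n) :
    ∃ μ : ∀ x : X', Γ(X', W x), (∀ x, IsUnit (μ x)) ∧ (∀ x, i.app (W x) (μ x) = 1) ∧
      ∀ (x y : X') (V : X'.Opens) (hx : V ≤ W x) (hy : V ≤ W y),
        secRes X' hy (μ y) = secRes X' hx (μ x) * c.g x y V (hx.trans (hWU x)) (hy.trans (hWU y)) ^ n := by
  classical
  -- `i♯` followed by restriction to `i⁻¹W_x ⊓ i⁻¹W_y` = `i♯` over `W_x ⊓ W_y` of the restriction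
  have hWW : ∀ x y : X', i ⁻¹ᵁ W x ⊓ i ⁻¹ᵁ W y ≤ i ⁻¹ᵁ (W x ⊓ W y) :=
    fun x y => UnitCocycle.le_preimage_inf i inf_le_left inf_le_right
  have happ : ∀ (x y : X') (s : Γ(X', W x)),
      secRes X (inf_le_left : i ⁻¹ᵁ W x ⊓ i ⁻¹ᵁ W y ≤ i ⁻¹ᵁ W x) (i.app (W x) s) =
        i.appLE (W x ⊓ W y) (i ⁻¹ᵁ W x ⊓ i ⁻¹ᵁ W y) (hWW x y) (secRes X' inf_le_left s) := by
    intro x y s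
    rw [appLE_secRes]
    rfl
  have happ' : ∀ (x y : X') (s : Γ(X', W y)),
      secRes X (inf_le_right : i ⁻¹ᵁ W x ⊓ i ⁻¹ᵁ W y ≤ i ⁻¹ᵁ W y) (i.app (W y) s) =
        i.appLE (W x ⊓ W y) (i ⁻¹ᵁ W x ⊓ i ⁻¹ᵁ W y) (hWW x y) (secRes X' inf_le_right s) := by
    intro x y s
    rw [appLE_secRes]
    rfl
  have hgone : ∀ x y : X', i.appLE (W x ⊓ W y) (i ⁻¹ᵁ W x ⊓ i ⁻¹ᵁ W y) (hWW x y)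
      (c.g x y (W x ⊓ W y) (inf_le_left.trans (hWU x)) (inf_le_right.trans (hWU y))) = 1 := by
    intro x y
    change secRes X (hWW x y) (i.app (W x ⊓ W y) (c.g x y (W x ⊓ W y) _ _)) = 1
    rw [hc, map_one]
  -- `λ_y⁻¹ = λ_x⁻¹ G^{-n}` (the relation for the inverses)
  have rel_inv : ∀ (x y : X') (V : X'.Opens) (hx : V ≤ W x) (hy : V ≤ W y),
      inv y V hy * c.g x y V (hx.trans (hWU x)) (hy.trans (hWU y)) ^ n = inv x V hx := by
    intro x y V hx hy
    calc inv y V hy * c.g x y V _ _ ^ n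
        = inv y V hy * c.g x y V _ _ ^ n * (lam x V hx * inv x V hx) := by rw [lam_mul_inv, mul_one]
      _ = (lam x V hx * c.g x y V (hx.trans (hWU x)) (hy.trans (hWU y)) ^ n) * inv y V hy * inv x V hx := by ring
      _ = inv x V hx := by rw [← rel x y V hx hy, lam_mul_inv, one_mul]
  -- the reductions of the `λ_x`, `λ_x⁻¹` glue to global sections `ū`, `v̄` of `X` with `ū v̄ = 1`
  have hcover : (⊤ : X.Opens) ≤ iSup fun x : X' => i ⁻¹ᵁ W x :=
    fun x _ => Opens.mem_iSup.2 ⟨i.base x, hWmem (i.base x)⟩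
  have hs : TopCat.Presheaf.IsCompatible X.presheaf (fun x : X' => i ⁻¹ᵁ W x)
      fun x => i.app (W x) (lam x (W x) le_rfl) := by
    intro x y
    change secRes X inf_le_left (i.app (W x) (lam x (W x) le_rfl)) = secRes X inf_le_right (i.app (W y) (lam y (W y) le_rfl))
    rw [happ, happ', map_lam, map_lam, rel x y (W x ⊓ W y) inf_le_left inf_le_right, map_mul, map_pow, hgone, one_pow,
      mul_one]
  have hs' : TopCat.Presheaf.IsCompatible X.presheaf (fun x : X' => i ⁻¹ᵁ W x)
      fun x => i.app (W x) (inv x (W x) le_rfl) := by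
    intro x y
    change secRes X inf_le_left (i.app (W x) (inv x (W x) le_rfl)) = secRes X inf_le_right (i.app (W y) (inv y (W y) le_rfl))
    rw [happ, happ', map_inv, map_inv, ← rel_inv x y (W x ⊓ W y) inf_le_left inf_le_right, map_mul, map_pow, hgone, one_pow,
      mul_one]
  have hglue : ∀ (t : ∀ x : X', Γ(X, i ⁻¹ᵁ W x)), TopCat.Presheaf.IsCompatible X.presheaf (fun x : X' => i ⁻¹ᵁ W x) t →
      ∃ w : Γ(X, ⊤), ∀ x : X', secRes X (le_top : i ⁻¹ᵁ W x ≤ ⊤) w = t x := by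
    intro t ht
    obtain ⟨w, hw, -⟩ := X.sheaf.existsUnique_gluing' (fun x : X' => i ⁻¹ᵁ W x) ⊤ (fun x => homOfLE le_top) hcover t ht
    exact ⟨w, hw⟩
  obtain ⟨ubar, hubar⟩ := hglue _ hs
  obtain ⟨vbar, hvbar⟩ := hglue _ hs'
  have huv : ubar * vbar = 1 := by
    refine X.sheaf.eq_of_locally_eq' (fun x : X' => i ⁻¹ᵁ W x) ⊤ (fun x => homOfLE le_top) hcover (ubar * vbar) 1
      fun x => ?_
    change secRes X (le_top : i ⁻¹ᵁ W x ≤ ⊤) (ubar * vbar) = secRes X (le_top : i ⁻¹ᵁ W x ≤ ⊤) 1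
    rw [map_mul, map_one, hubar, hvbar, ← map_mul, lam_mul_inv, map_one]
  -- lift the global unit `ū` to a global unit `u` of `X'` and untwist
  obtain ⟨u, hu, hiu⟩ := hlift ubar (IsUnit.of_mul_eq_one _ huv)
  obtain ⟨uinv, huuinv⟩ := hu.exists_right_inv
  have hiuinv : i.appTop uinv * ubar = 1 := by rw [← hiu, ← map_mul, mul_comm, huuinv, map_one]
  refine ⟨fun x => lam x (W x) le_rfl * secRes X' le_top uinv, fun x => ?_, fun x => ?_, fun x y V hx hy => ?_⟩
  · exact (IsUnit.of_mul_eq_one _ (lam_mul_inv x _ le_rfl)).mul ((IsUnit.of_mul_eq_one_right _ huuinv).map (secRes X' le_top))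
  · rw [map_mul, app_secRes, ← hubar x]
    change secRes X (le_top : i ⁻¹ᵁ W x ≤ ⊤) ubar * secRes X (le_top : i ⁻¹ᵁ W x ≤ ⊤) (i.appTop uinv) = 1
    rw [← map_mul, mul_comm, hiuinv, map_one]
  · rw [map_mul, map_mul, secRes_secRes, secRes_secRes, map_lam, map_lam, rel x y V hx hy]
    have e : secRes X' (hy.trans (le_top : W y ≤ ⊤)) uinv = secRes X' (hx.trans (le_top : W x ≤ ⊤)) uinv := rfl
    rw [e]
    ring

/-- **TORSION RIGIDITY OF `Ȟ¹(𝒪^×)` ALONG A NILPOTENT THICKENING.**  Let `i : X ⟶ X'` be a surjective closed immersion such that every unit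
of `Γ(X, 𝒪_X)` lifts to a unit of `Γ(X', 𝒪_{X'})`, and let `n` be invertible in `Γ(X', 𝒪_{X'})`.  Then an `n`-TORSION class
`a ∈ Ȟ¹(X', 𝒪^×_{X'})` with `i^* a = 1` is TRIVIAL.  (Step (c): over affine charts the units `μ_x ≡ 1` of Step (b) have unipotent `n`-th roots
`ρ_x` (§1), and `G_{xy} = ρ_x⁻¹ ρ_y` holds locally by injectivity of `n`-th powers on unipotent units, hence globally.)  Equivalently: the
kernel of `Pic X' → Pic X` has no `n`-torsion ([Hartshorne1977] III Ex. 4.6: it is filtered by `Γ`-modules `H¹(𝒥^k/𝒥^{k+1})`).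
[cite: Hartshorne1977, III Ex. 4.6] [cite: Hartshorne2010, §6 Thm. 6.4 (b) and its proof (pp. 50–51)] [cite: AtiyahMacdonald1969, Ch. 10 Ex. 9] -/
theorem CechPic.eq_one_of_pow_eq_one_of_pullback_eq_one
    (hlift : ∀ u : Γ(X, ⊤), IsUnit u → ∃ v : Γ(X', ⊤), IsUnit v ∧ i.appTop v = u)
    {n : ℕ} (hn : IsUnit (n : Γ(X', ⊤))) {a : CechPic X'} (hpow : a ^ n = 1) (hpull : CechPic.pullback i a = 1) :
    a = 1 := by
  classical
  obtain ⟨c₁, rfl⟩ := CechPic.mk_surjective a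
  obtain ⟨c, hcc, hc⟩ := UnitCocycle.exists_app_eq_one_of_pullback_eq_one i c₁ hpull
  rw [← hcc] at hpow ⊢
  obtain ⟨W, hWmem, hWU, lam, inv, map_lam, map_inv, lam_mul_inv, rel⟩ :=
    UnitCocycle.exists_datum_of_mk_pow_eq_one c n hpow
  obtain ⟨μ, hμu, hμ1, hrel⟩ :=
    UnitCocycle.exists_units_app_eq_one i hlift c hc n W hWmem hWU lam inv map_lam map_inv lam_mul_inv rel
  -- affine charts `B_x ∋ x` inside `W_x`
  have hB : ∀ x : X', ∃ B : X'.affineOpens, x ∈ B.1 ∧ B.1 ≤ W x := fun x => exists_affineOpens_le (hWmem x)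
  choose B hBmem hBW using hB
  -- unipotent `n`-th roots `ρ_x` of `μ_x|_{B_x}` (§1)
  have hρ : ∀ x : X', ∃ ρ : Γ(X', (B x).1), IsNilpotent (ρ - 1) ∧ ρ ^ n = secRes X' (hBW x) (μ x) := by
    intro x
    refine exists_pow_eq_of_isNilpotent_sub_one (isUnit_natCast_of_ringHom (secRes X' (le_top : (B x).1 ≤ ⊤)) hn) ?_
    refine isNilpotent_of_app_eq_zero_of_isAffineOpen i (B x).2 ?_
    rw [map_sub, map_one, app_secRes, hμ1, map_one, sub_self]
  choose ρ hρnil hρpow using hρ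
  have hρunit : ∀ x, IsUnit (ρ x) := fun x => by
    have h := (hρnil x).isUnit_add_one
    rwa [sub_add_cancel] at h
  -- `i♯ρ_x = 1` (the reduction is an `n`-th root of `1` congruent to `1`)
  have hiρ : ∀ x, i.app (B x).1 (ρ x) = 1 := by
    intro x
    refine eq_of_pow_eq_pow_of_isNilpotent_sub (n := n)
      (isUnit_natCast_of_ringHom ((i.app (B x).1).hom.comp (secRes X' (le_top : (B x).1 ≤ ⊤))) hn) isUnit_one ?_ ?_
    · have e : i.app (B x).1 (ρ x) - 1 = i.app (B x).1 (ρ x - 1) := by rw [map_sub, map_one]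
      rw [e]
      exact (hρnil x).map _
    · rw [one_pow, ← map_pow, hρpow, app_secRes, hμ1, map_one]
  -- the coboundary `G_{xy} = ρ_x⁻¹ ρ_y`: `n`-th powers agree, the difference is nilpotent locally, §1 locally, sheaf axiom globally
  have hrelρ : ∀ (x y : X') (V : X'.Opens) (hx : V ≤ (B x).1) (hy : V ≤ (B y).1),
      secRes X' hy (ρ y) = secRes X' hx (ρ x) * c.g x y V (hx.trans ((hBW x).trans (hWU x))) (hy.trans ((hBW y).trans (hWU y))) := by
    intro x y V hx hy
    have hpowV : (secRes X' hy (ρ y)) ^ n =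
        (secRes X' hx (ρ x) * c.g x y V (hx.trans ((hBW x).trans (hWU x))) (hy.trans ((hBW y).trans (hWU y)))) ^ n := by
      rw [mul_pow, ← map_pow (secRes X' hy), ← map_pow (secRes X' hx), hρpow, hρpow, secRes_secRes, secRes_secRes]
      exact hrel x y V (hx.trans (hBW x)) (hy.trans (hBW y))
    have hD : ∀ p : V, ∃ D : X'.affineOpens, (p : X') ∈ D.1 ∧ D.1 ≤ V := fun p => exists_affineOpens_le p.2
    choose D hDmem hDV using hD
    refine X'.sheaf.eq_of_locally_eq' (fun p : V => (D p).1) V (fun p => homOfLE (hDV p))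
      (fun q hq => Opens.mem_iSup.2 ⟨⟨q, hq⟩, hDmem ⟨q, hq⟩⟩) _ _ fun p => ?_
    change secRes X' (hDV p) (secRes X' hy (ρ y)) =
      secRes X' (hDV p) (secRes X' hx (ρ x) * c.g x y V (hx.trans ((hBW x).trans (hWU x))) (hy.trans ((hBW y).trans (hWU y))))
    refine eq_of_pow_eq_pow_of_isNilpotent_sub (n := n)
      (isUnit_natCast_of_ringHom (secRes X' (le_top : (D p).1 ≤ ⊤)) hn) ?_ ?_ ?_
    · exact (((hρunit x).map _).mul (c.isUnit_g x y V _ _)).map _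
    · refine isNilpotent_of_app_eq_zero_of_isAffineOpen i (D p).2 ?_
      rw [← map_sub, app_secRes, map_sub, map_mul, app_secRes, app_secRes, hiρ, hiρ, hc, map_one, map_one, mul_one,
        sub_self, map_zero]
    · rw [← map_pow (secRes X' (hDV p)), ← map_pow (secRes X' (hDV p)), hpowV]
  rw [← CechPic.mk_one]
  exact CechPic.sound ⟨{
    W := fun x => (B x).1
    mem := hBmem
    le := fun x => (hBW x).trans (hWU x)
    le' := fun x => le_top
    lam := fun x V h => secRes X' h (ρ x)
    inv := fun x V h => secRes X' h (((hρunit x).unit⁻¹ : (Γ(X', (B x).1))ˣ) : Γ(X', (B x).1))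
    map_lam := fun x V V' h j => by rw [secRes_secRes]
    lam_mul_inv := fun x V h => by rw [← map_mul, IsUnit.mul_val_inv, map_one]
    rel := fun x y V hx hy => by
      change (1 : Γ(X', V)) * secRes X' hy (ρ y) = secRes X' hx (ρ x) * c.g x y V _ _
      rw [one_mul]
      exact hrelρ x y V hx hy }⟩

end Torsion

/-! ## The product form: `P ⊗ T₀ ↪ P ⊗ T` for a nilpotent thickening `T₀ ↪ T` of the parameter scheme -/

section Product

variable {S : Scheme.{u}} (P : Over S) {T₀ T : Over S} (τ : T₀ ⟶ T)

/-- `(P ⊗ T₀).left → (P ⊗ T).left` is the base change of `T₀.left → T.left` along the projection `(P ⊗ T).left → T.left` (the tensor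
product of `Over S` is the fibre product over `S`). [folklore] -/
private theorem isPullback_whiskerLeft_left :
    IsPullback (P ◁ τ).left (Limits.pullback.snd P.hom T₀.hom) (Limits.pullback.snd P.hom T.hom) τ.left := by
  refine IsPullback.of_right ?_ (Over.whiskerLeft_left_snd τ) (IsPullback.of_hasPullback P.hom T.hom)
  rw [Over.whiskerLeft_left_fst, Over.w τ]
  exact IsPullback.of_hasPullback P.hom T₀.hom

/-- A bijective ring map reflects units. [folklore] -/
private theorem isUnit_of_bijective {A B : Type*} [CommRing A] [CommRing B] (f : A →+* B) (hf : Function.Bijective f) {a : A}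
    (ha : IsUnit (f a)) : IsUnit a := by
  obtain ⟨b, hb⟩ := ha.exists_right_inv
  obtain ⟨a', rfl⟩ := hf.2 b
  rw [← map_mul, ← map_one f] at hb
  exact IsUnit.of_mul_eq_one _ (hf.1 hb)

/-- **TORSION RIGIDITY, PRODUCT FORM** (the shape the abelian-scheme consumer instantiates): let `P → S` be an `S`-scheme, `τ : T₀ ⟶ T` a morphism
of `S`-schemes whose underlying map is a SURJECTIVE CLOSED IMMERSION (e.g. `Spec κ ↪ Spec 𝒪/𝔪^{k+1}`), and assume `P ×_S T₀` is STEIN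
over `T₀` on global sections (`Γ(T₀, 𝒪) → Γ(P ×_S T₀, 𝒪)` bijective — for an abelian scheme over a locally Noetherian base ★
`AbelianSchemeOver.baseChange_appTop_bijective`), that units of `Γ(T₀, 𝒪)` lift to units of `Γ(T, 𝒪)` along `τ` and that `n` is a unit
in `Γ(T, 𝒪)`.  Then an `n`-torsion class on `P ×_S T` that dies on `P ×_S T₀` is trivial.
[cite: Hartshorne1977, III Ex. 4.6] [cite: Hartshorne2010, §6 Thm. 6.4 (b) and its proof (pp. 50–51)] -/
theorem CechPic.eq_one_of_pow_eq_one_of_pullback_whiskerLeft_eq_one [IsClosedImmersion τ.left] [Surjective τ.left]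
    (hStein₀ : Function.Bijective (Limits.pullback.snd P.hom T₀.hom).appTop)
    (hliftT : ∀ u : Γ(T₀.left, ⊤), IsUnit u → ∃ v : Γ(T.left, ⊤), IsUnit v ∧ τ.left.appTop v = u)
    {n : ℕ} (hn : IsUnit (n : Γ(T.left, ⊤))) {a : CechPic (P ⊗ T).left} (hpow : a ^ n = 1)
    (hpull : CechPic.pullback (P ◁ τ).left a = 1) : a = 1 := by
  haveI : IsClosedImmersion (P ◁ τ).left :=
    MorphismProperty.of_isPullback (P := @IsClosedImmersion) (isPullback_whiskerLeft_left P τ).flip inferInstance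
  haveI : Surjective (P ◁ τ).left :=
    MorphismProperty.of_isPullback (P := @Surjective) (isPullback_whiskerLeft_left P τ).flip inferInstance
  refine CechPic.eq_one_of_pow_eq_one_of_pullback_eq_one (P ◁ τ).left (fun u hu => ?_)
    (isUnit_natCast_of_ringHom (Limits.pullback.snd P.hom T.hom).appTop.hom hn) hpow hpull
  -- units of `Γ(P ×_S T₀, 𝒪) = Γ(T₀, 𝒪)` lift to units of `Γ(P ×_S T, 𝒪) = Γ(T, 𝒪)`
  obtain ⟨u₀, rfl⟩ := hStein₀.2 u
  have hu₀ : IsUnit u₀ := isUnit_of_bijective (Limits.pullback.snd P.hom T₀.hom).appTop.hom hStein₀ hu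
  obtain ⟨v₀, hv₀, hτ⟩ := hliftT u₀ hu₀
  refine ⟨(Limits.pullback.snd P.hom T.hom).appTop v₀, hv₀.map _, ?_⟩
  rw [← hτ]
  have key := ConcreteCategory.congr_hom (congrArg Scheme.Hom.appTop (Over.whiskerLeft_left_snd (R := P) τ)) v₀
  rw [Scheme.Hom.comp_appTop, Scheme.Hom.comp_appTop] at key
  try simp only [CategoryTheory.comp_apply] at key
  exact key

end Product

end Literature.AlgebraicGeometry.Modules

end
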